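import Literature.MathematicalPhysics.QuantumFieldTheory.Balaban1983to89.B9SectDWalkThrough
import Literature.MathematicalPhysics.QuantumFieldTheory.Balaban1983to89.B13PrimitiveKernels216Reduced

/-!
# `Balaban1983to89.B13SigmaThroughWalks` — T. Bałaban, *Renormalization group approach to lattice gauge field
theories. II. Cluster expansions*, Commun. Math. Phys. **116** (1988) 1–22 [Balaban1988RG2Cluster], p. 5 (1.11), p. 13,
p. 16 (2.16): the OBJECT-LEVEL STRUCTURE behind the σ-part «O(1)e^{−⅓δ₀M}» of (2.16), typed as ONE named hypothesis shape
`SigmaThroughWalks` — *a kernel family `σ ↦ K(σ)` is represented entrywise by a generalized random walk expansion whose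
terms depend on the decoupling parameters σ only for walks passing THROUGH a set `X`, with per-term bounds of the
(3.108)∕(1.11) shape uniform on the σ-polydisc* — and the THEOREM that this structure, the expansion's summability at a
reduced rate (`B9SectDWalk.MajSumLe`) and `dist(X, ·) ≥ R` on the row indices give the (2.16)-type σ-difference bound
`‖(K(σ) − K(0))(b,j)‖ ≤ 2K̄₀e^{−εR}·e^{−κd₁(b,j)}`: LITERALLY the σ-part binders `hσΓ`, `hσE` ((T3a) of the cell's row (D4),
NODE A.4) of `B13PrimitiveKernels216Reduced.differences216_of_analytic_two`, hence `Differences216` (L16a) for one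
(2.14)-term WITHOUT any σ-part bound among the hypotheses (`differences216_of_walks_two`)

statement-level skeleton of published theorems with citation tags; proofs where landed; nothing here is a claim about
the Yang–Mills mass gap

Sources: [II] = [Balaban1988RG2Cluster]; [B9] = T. Bałaban, *Propagators for lattice gauge theories in a background
field*, Commun. Math. Phys. **99** (1985) 389–434 [Balaban1985BackgroundPropagators] (= ref. [13] of [II]), (3.93)
p. 410, (3.108) p. 416, (3.154) p. 427.  Held text `paper:balaban1988-cmp116-rg-ii-cluster` pp. 5, 13–16 re-read this
session by the filing seat (materialised `p0005.txt`, `p0013.txt`–`p0016.txt`) AND checked against the page renders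
`b2b-balaban-ref1/pages/1988-cmp116-rg-II-cluster/…-p005-x2.png`, `…-p013-x2.png`, `…-p016-x2.png` (the OCR drops
fractions).

CITATION HEADER (verbatim from the renders).  p. 5 [PDF 5], (1.11) and after: *"the parameters s(Y₀) are complex valued
and satisfy the bound |s(Δ)| ≦ e^{κ₁} for Δ ⊂ Y₀∖□̃⁴, κ₁ is a sufficiently big positive number. Using the bound (1.7) we
estimate the function by* `B₀|X| sup_ω M₁^{−½|ω|} exp(−δ₀d(ω)) e^{mκ₁}`, *(1.11) where d(ω) is a length of a shortest tree
graph intersecting all localization domains of ω, m is the number of the parameters s connected with the walk ω. If m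
is big enough, for example m > 2⁴, then δ₀d(ω) ≧ δ₁mM, for a positive constant δ₁ depending on δ₀ only, and we can bound
the expression under the supremum in (1.11) by 1, for δ₁M ≧ κ₁. If m ≦ 2⁴, then we can have short walks, in fact with
|ω| = 0, and the expression can be bounded by e^{16κ₁} only."*; p. 13 [PDF 13]: *"We define σ₀ as the family of such
cubes Δ disjoint with the interior of Z̃₀, or with the interior of Z′₀ … The parameters s(Δ), Δ ∈ σ₀, are introduced
into the operators as before, but the generalized random expansions are constructed now in a slightly different way. …
Other localization domains X are chosen as in Sect. C [13], i.e. they are unions of small, connected families of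
M₁-cubes, and we assume that dist(X, Z₀) > ⅔M. For this class of localization domains we construct the generalized
random walk expansions."* (render-checked: the printed fraction is **⅔**; the module header of `B9SectDWalkThrough`
quotes this sentence with «⅓M» — a located transcription slip recorded by the cell, the theorem there is unaffected:
its `R` is a parameter); p. 16 [PDF 16]: `|R₁(b, b′)| ≦ (O(1)e^{−1/3δ₀M} + O(α₀ + α₁)) exp(−½δ₀|b₋ − b′₋|).` *(2.16) We
have assumed, as in Sect. 1, that M is much bigger than κ₁, especially that e^{−1/3δ₀M}e^{16κ₁} < 1."*

WHAT IS REPRODUCED (cell `pub-balaban-gaps`, track G1, prover seat g1-p2 gen 3; binder (D4), NODE A.4 = (T3), item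
(T3a); a NEW LEAF over `B9SectDWalkThrough` (this seat, p344495) and `B13PrimitiveKernels216Reduced` (this seat,
p344645); nothing edited):
* §1 `SigmaThroughWalks` — the named hypothesis shape (a `structure … : Prop` over an abstract `B6.Geometry`, D-0026):
  for a kernel family `K : S → Matrix p n ℂ` on a parameter set `P ⊆ S` with reference point `s₀`, a family of walk terms
  `T : W → S → Matrix p n ℂ`, a σ-CARRYING sub-family `SX ⊆ W`, a set of sites `X`, constants `A_ω ≥ 0`, walk distances
  `D_ω` and a rate `ρ`: (hasSum) `K(s)(i,j) = Σ_ω T_ω(s)(i,j)` entrywise (Mathlib `HasSum`: the limit of the finite partial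
  sums — print's convergent expansion); (indep) `T_ω(s) = T_ω(s₀)` for `ω ∉ SX` (print: the term carries no parameter s,
  `m = 0` in (1.11)); (through) `D_ω` passes through `X` for `ω ∈ SX` (`B9SectDWalk.Through`, (3.93)); (maj) the per-term
  bound `‖T_ω(s)(i,j)‖ ≤ A_ω e^{−ρD_ω(loc i, loc j)}` UNIFORMLY on `P` (print: (1.11) with `e^{mκ₁}` absorbed by
  `δ₁M ≥ κ₁` ∕ `e^{−⅓δ₀M}e^{16κ₁} < 1` — that absorption is OBJECT-level content and stays inside this hypothesis).
* §2 `sub_ref_entry_le` — THE THEOREM: `SigmaThroughWalks` + `MajSumLe` of the reduced-rate majorants `A_ω e^{−(ρ−ε)D_ω}`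
  with bound `K̄` + `d(loc i, z) ≥ R` for all `z ∈ X` ⟹ `‖(K(s) − K(s₀))(i,j)‖ ≤ 2K̄(loc i, loc j)e^{−εR}` for every `s ∈ P`
  (Mathlib `HasSum.norm_le_of_bounded` over the majorant family `2A_ω e^{−ρD_ω}·𝟙_{SX}`, whose partial sums are bounded by
  `B9SectDWalkThrough.subfamily_far_sum_le`); `sigmaThroughWalks_const` — non-vacuity (a σ-independent kernel is its own
  one-term expansion with `SX = ∅`).
* §3 `sub_ref_entry_le_torus` — the same on the papers' carrier: the one-scale ℓ¹ site torus
  `B9Thm34Ext.toB6 (B9Thm37GlueTorus.torusGeom Nf 0 0 0) 0 True` (sites `UT Nf`, distance `tdist1 Nf`; the length data and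
  [4]'s (2.1)–(2.2) slot are not read by the walk bookkeeping and are set to `0` ∕ `True`), the σ-polydisc
  `{σ | ∀ j, ‖σ_j‖ ≤ e^{κ₁}}` with reference `σ = 0`, and `K̄ = K̄₀e^{−κd₁}`: the conclusion is LITERALLY the binder shape
  `∀ σ, (∀ j, ‖σ j‖ ≤ e^{κ₁}) → ∀ b j, ‖(K σ − K 0) b j‖ ≤ θ_σ·e^{−κ·d₁(loc b, loc j)}` with `θ_σ := 2K̄₀e^{−εR}` BY NAME.
* §4 `differences216_of_walks_two` — `B13PrimitiveKernels216Reduced.differences216_of_analytic_two` with its two (T3a)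
  binders `hσΓ`, `hσE` DISCHARGED by §3: `Differences216` (L16a) at the configuration `u` for one (2.14)-term from
  `SigmaThroughWalks` data for `σ ↦ G(σ,0)` and `σ ↦ A(σ,0)`, their reduced-rate summability bounds `K̄_Γ`, `K̄_E`, the
  far-ness `dist(X, loc Λ) ≥ R_σ`, and the (T3b) analyticity ∕ majorant clauses — NO σ-part bound is assumed any more;
  `θ_Γ = 2K̄_Γe^{−εR_σ} + 2K_Gα/R`, `θ_E = 2K̄_Ee^{−εR_σ} + 2K_Eα/R` (print: `O(1)e^{−⅓δ₀M} + O(α₀ + α₁)`).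
* §5 `entry_le_of_hasSum_majorants`, `SigmaThroughWalks.entry_le`, `majorant_torus_of_hasSum` — the SAME object gives
  the uniform localisation: an entrywise `HasSum` expansion with per-term bounds uniform on the parameter set and a
  `MajSumLe`-bound `K̄` at the FULL rate yields `‖K(s)(i,j)‖ ≤ K̄(loc i, loc j)` ([B9] p. 416 *"This implies Theorem
  3.3"*, entrywise); on polydisc × ball with `K̄ = K̄₀e^{−κd₁}` this is literally the (T3b)-majorant binder shape `hmΓ`,
  `hmE`, `hmC` of §4 (and of `B13PrimitiveKernels216.localisation17a_of_majorants`, i.e. L17a).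
CENSUS MEANING (row (D4).NODE-A, words unchanged): the by-assertion input (T3a) «σ-part bounds, asserted at (2.16), no
printed derivation» is REPLACED by a hypothesis of the same OBJECT-level kind as L17a's walk expansions (cell GAPS
G-B9-10): the expansion EXISTS with σ carried only by walks through the far region; and the L17a-type uniform majorants
are consequences of the same expansion (§5).  Given that object, every (2.16)∕L17a-type ESTIMATE feeding (2.26) for one
term is a kernel theorem; by assertion remain the EXISTENCE of the expansions for Bałaban's operators in complex
backgrounds with k-uniform constants (G-B9-10, [9] Sect. A), the entries' analyticity in (𝐔, 𝐉) (p. 15), `TermDomination`.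
HONEST SCOPE.  Elementary real analysis (comparison of an entrywise `HasSum` with a summable majorant family) and
plumbing; no walk expansion of any operator of Bałaban's is constructed, the absorption of `e^{mκ₁}` is not performed,
whether [II]'s kernels `Γ_k(Z₀,σ)`, `C^{(k)}(Z₀,σ)^{−1}` admit `SigmaThroughWalks` data is the open OBJECT-level content
(NODE O ∕ G-B9-10), not proved here.  One new hypothesis-shape `structure … : Prop` (no data definition), no `sorry`, no
new named fact.  NOT B12 Thm 2, NOT `BetaPertH`, NOT continuum∕ℝ⁴, NOT Clay.
-/

namespace Literature.MathematicalPhysics.QuantumFieldTheory.Balaban1983to89.B13SigmaThroughWalks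

open Metric Set Matrix Finset
open Literature.MathematicalPhysics.QuantumFieldTheory.Balaban1983to89
open Literature.MathematicalPhysics.QuantumFieldTheory.Balaban1983to89.B9SectDWalk (Through MajSumLe)
open Literature.MathematicalPhysics.QuantumFieldTheory.Balaban1983to89.B9SectDWalkThrough (subfamily_far_sum_le)
open Literature.MathematicalPhysics.QuantumFieldTheory.Balaban1983to89.B9Thm34Ext (toB6)
open Literature.MathematicalPhysics.QuantumFieldTheory.Balaban1983to89.B9Thm37GlueTorus (torusGeom tdist1 tdist1_nonneg)
open Literature.MathematicalPhysics.QuantumFieldTheory.Balaban1983to89.TreeLengthTorus (TPt)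
open Literature.MathematicalPhysics.QuantumFieldTheory.Balaban1983to89.B5TorusCover (UT)
open Literature.MathematicalPhysics.QuantumFieldTheory.Balaban1983to89.B13PrimitiveKernels216 (Differences216)
open Literature.MathematicalPhysics.QuantumFieldTheory.Balaban1983to89.B13PrimitiveKernels216Reduced
  (differences216_of_analytic_two)

noncomputable section

/-! ## §1. The hypothesis shape: σ enters the kernel only through walk terms passing through `X` -/

section Shape

variable {g : B6.Geometry}

/-- **σ THROUGH WALKS** (named hypothesis shape, OBJECT level).  A kernel family `K : S → Matrix p n ℂ` on the parameter
set `P` (print: the σ-polydisc `|s(Δ)| ≦ e^{κ₁}`) with reference point `s₀` (print: `σ(Z) = 0`), row∕column indices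
located on the sites of the geometry `g` by `locp`, `locn`, is REPRESENTED by the walk terms `T_ω(s)`, `ω : W`:
* `hasSum` — entrywise `K(s)(i,j) = Σ_ω T_ω(s)(i,j)` for `s ∈ P` (the convergent generalized random walk expansion,
  [B9] Thm 3.10 ∕ (3.107), as the limit of its finite partial sums);
* `indep` — a term outside the σ-carrying sub-family `SX` does not depend on the parameter: `T_ω(s) = T_ω(s₀)` (print,
  (1.11): *"m is the number of the parameters s connected with the walk ω"* — these are the terms with `m = 0`);
* `through` — the walk distance `D_ω` of a σ-carrying term passes THROUGH `X` ((3.93): some intermediate point lies in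
  `X`; print p. 13: the parameters sit on the cubes `Δ ∈ σ₀` outside `Z̃₀` and the other localization domains have
  `dist(X, Z₀) > ⅔M`);
* `A_nonneg`, `maj` — the per-term bound of the (3.108)∕(1.11) shape `‖T_ω(s)(i,j)‖ ≤ A_ω e^{−ρD_ω(loc i, loc j)}`,
  UNIFORM in `s ∈ P` (print: `e^{mκ₁}` absorbed by `δ₁M ≧ κ₁`, p. 5, and `e^{−⅓δ₀M}e^{16κ₁} < 1`, p. 16).
Whether Bałaban's kernels admit such data is NOT asserted (cell GAPS G-B9-10, NODE O).
[cite: Balaban1988RG2Cluster, (1.11) p.5, p.13, (2.16) p.16] -/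
structure SigmaThroughWalks (g : B6.Geometry) {S : Type*} (P : Set S) (s₀ : S) {p n : Type} (locp : p → g.Site)
    (locn : n → g.Site) (K : S → Matrix p n ℂ) {W : Type} (T : W → S → Matrix p n ℂ) (SX : Set W)
    (X : Finset g.Site) (A : W → ℝ) (D : W → g.Site → g.Site → ℝ) (ρ : ℝ) : Prop where
  hasSum : ∀ s ∈ P, ∀ i j, HasSum (fun ω => T ω s i j) (K s i j)
  indep : ∀ ω, ω ∉ SX → ∀ s ∈ P, T ω s = T ω s₀
  through : ∀ ω ∈ SX, Through g (D ω) (↑X : Set g.Site)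
  A_nonneg : ∀ ω, 0 ≤ A ω
  maj : ∀ ω, ∀ s ∈ P, ∀ i j, ‖T ω s i j‖ ≤ A ω * Real.exp (-(ρ * D ω (locp i) (locn j)))

end Shape

/-! ## §2. The theorem: the σ-difference is the far sub-family, hence `≤ 2K̄e^{−εR}` -/

section Bound

variable {g : B6.Geometry}
variable {S : Type*} {P : Set S} {s₀ : S} {p n : Type} {locp : p → g.Site} {locn : n → g.Site}
variable {K : S → Matrix p n ℂ} {W : Type} {T : W → S → Matrix p n ℂ} {SX : Set W} {X : Finset g.Site}
variable {A : W → ℝ} {D : W → g.Site → g.Site → ℝ} {ρ : ℝ}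

/-- **THE σ-PART OF (2.16) FROM THE WALK STRUCTURE.**  If `σ ↦ K(σ)` has `SigmaThroughWalks` data, the reduced-rate
majorant family `(A_ω e^{−(ρ−ε)D_ω})_ω` has uniformly bounded partial sums `≤ K̄` (`MajSumLe`, the expansion's convergence
clause), and every point of `X` is at distance `≥ R` from the location of every ROW index (print: `dist(X, Z₀) > ⅔M`, the
rows being bonds of `Z₀`), then for every parameter `s ∈ P` (and `s₀ ∈ P`)
`‖(K(s) − K(s₀))(i,j)‖ ≤ 2·K̄(loc i, loc j)·e^{−εR}`: the difference is the sum over the σ-carrying sub-family of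
`T_ω(s) − T_ω(s₀)`, each bounded by twice its majorant, and that sub-family passes through the far set `X`
(`B9SectDWalkThrough.subfamily_far_sum_le`).  With `εR = ⅓δ₀M` this is print's «O(1)e^{−⅓δ₀M}».
[cite: Balaban1988RG2Cluster, (2.16) p.16, p.13, (1.11) p.5; Balaban1985BackgroundPropagators, (3.154) p.427] -/
theorem sub_ref_entry_le (h : SigmaThroughWalks g P s₀ locp locn K T SX X A D ρ) (h₀ : s₀ ∈ P)
    (hd : ∀ a b : g.Site, 0 ≤ g.dist a b) {ε R : ℝ} (hε : 0 ≤ ε) {Kbar : g.Site → g.Site → ℝ}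
    (hsum : MajSumLe (fun ω a b => A ω * Real.exp (-((ρ - ε) * D ω a b))) Kbar)
    (hfar : ∀ i : p, ∀ z ∈ X, R ≤ g.dist (locp i) z) {s : S} (hs : s ∈ P) (i : p) (j : n) :
    ‖(K s - K s₀) i j‖ ≤ 2 * Kbar (locp i) (locn j) * Real.exp (-(ε * R)) := by
  classical
  -- the entrywise difference is the sum of the term differences
  have hdiff : HasSum (fun ω => T ω s i j - T ω s₀ i j) ((K s - K s₀) i j) := by
    rw [Matrix.sub_apply]
    exact (h.hasSum s hs i j).sub (h.hasSum s₀ h₀ i j)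
  -- the majorant family: twice the per-term bound on the σ-carrying sub-family, zero elsewhere
  obtain ⟨m, hm⟩ : ∃ m : W → ℝ,
      ∀ ω, m ω = if ω ∈ SX then 2 * (A ω * Real.exp (-(ρ * D ω (locp i) (locn j)))) else 0 :=
    ⟨fun ω => if ω ∈ SX then 2 * (A ω * Real.exp (-(ρ * D ω (locp i) (locn j)))) else 0, fun _ => rfl⟩
  have hle : ∀ ω, ‖T ω s i j - T ω s₀ i j‖ ≤ m ω := by
    intro ω
    by_cases hω : ω ∈ SX
    · rw [hm ω, if_pos hω, two_mul]
      exact (norm_sub_le _ _).trans (add_le_add (h.maj ω s hs i j) (h.maj ω s₀ h₀ i j))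
    · rw [hm ω, if_neg hω, h.indep ω hω s hs, sub_self, norm_zero]
  have hm0 : ∀ ω, 0 ≤ m ω := fun ω => (norm_nonneg _).trans (hle ω)
  -- its partial sums are the far sub-family sums, bounded by `subfamily_far_sum_le`
  have hpart : ∀ Sf : Finset W, ∑ ω ∈ Sf, m ω ≤ 2 * Kbar (locp i) (locn j) * Real.exp (-(ε * R)) := by
    intro Sf
    have hrew : ∑ ω ∈ Sf, m ω =
        2 * ∑ ω ∈ Sf.filter (fun ω => ω ∈ SX), A ω * Real.exp (-(ρ * D ω (locp i) (locn j))) := by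
      rw [Finset.sum_filter, Finset.mul_sum]
      refine Finset.sum_congr rfl fun ω _ => ?_
      rw [hm ω]
      split_ifs <;> simp
    rw [hrew, mul_assoc]
    refine mul_le_mul_of_nonneg_left ?_ (by norm_num)
    by_cases hne : (Sf.filter (fun ω => ω ∈ SX)).Nonempty
    · obtain ⟨ω₀, hω₀⟩ := hne
      obtain ⟨z, hz, -⟩ := h.through ω₀ (Finset.mem_filter.1 hω₀).2 (locp i) (locn j)
      have hX : X.Nonempty := ⟨z, Finset.mem_coe.1 hz⟩
      exact subfamily_far_sum_le hX hd hε h.A_nonneg hsum (Sf.filter (fun ω => ω ∈ SX))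
        (fun ω hω => h.through ω (Finset.mem_filter.1 hω).2) (hfar i) (locn j)
    · rw [Finset.not_nonempty_iff_eq_empty.1 hne, Finset.sum_empty]
      exact mul_nonneg (hsum.nonneg _ _) (Real.exp_pos _).le
  have hmsum : Summable m := summable_of_sum_le (fun ω => hm0 ω) hpart
  exact (hdiff.norm_le_of_bounded hmsum.hasSum hle).trans (hmsum.tsum_le_of_sum_le hpart)

/-- **Non-vacuity of the shape** (the degenerate printed case *"m is the number of the parameters s connected with the
walk ω"* `= 0` for every term): a σ-INDEPENDENT kernel (`K(s) = K(s₀)` on `P`) is its own one-term expansion with empty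
σ-carrying sub-family (`W = Unit`, `SX = ∅`), for any majorant data bounding the one term.
[cite: Balaban1988RG2Cluster, (1.11) p.5] -/
theorem sigmaThroughWalks_const {K : S → Matrix p n ℂ} (hK : ∀ s ∈ P, K s = K s₀) (X : Finset g.Site)
    {A₀ : ℝ} (hA₀ : 0 ≤ A₀) {D₀ : g.Site → g.Site → ℝ} {ρ : ℝ}
    (hmaj : ∀ i j, ‖K s₀ i j‖ ≤ A₀ * Real.exp (-(ρ * D₀ (locp i) (locn j)))) :
    SigmaThroughWalks g P s₀ locp locn K (fun (_ : Unit) s => K s) (∅ : Set Unit) X (fun _ => A₀) (fun _ => D₀) ρ where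
  hasSum s _ i j := by simp
  indep _ _ s hs := hK s hs
  through ω hω := by simp at hω
  A_nonneg _ := hA₀
  maj _ s hs i j := by rw [hK s hs]; exact hmaj i j

end Bound

/-! ## §3. On the papers' carrier: the one-scale ℓ¹ site torus and the σ-polydisc — the (T3a) binder shape BY NAME -/

section Torus

variable {d N' : ℕ} {ν : ℕ} {Nf : Fin ν → ℕ} [∀ i, NeZero (Nf i)]
variable {p n : Type}

/-- **(T3a) FROM THE WALK STRUCTURE, on the site torus.**  For a kernel family `σ ↦ K(σ)` of a (2.14)-term (rows `p` and
columns `n` located on the site torus `UT Nf` by `locp`, `locn`) with `SigmaThroughWalks` data over the one-scale ℓ¹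
torus geometry (distance `tdist1 Nf`) on the σ-polydisc `‖σ_j‖ ≤ e^{κ₁}` with reference `σ = 0`, reduced-rate summability
bound `K̄₀e^{−κd₁}` and `d₁(loc i, z) ≥ R` for `z ∈ X`: for every σ of the polydisc and all `b, j`,
`‖(K σ − K 0)(b,j)‖ ≤ (2K̄₀e^{−εR})·e^{−κd₁(loc b, loc j)}` — literally the σ-part binders `hσΓ` (columns `Λ ⊕ C₀`) and
`hσE` (columns `Λ`) of `B13PrimitiveKernels216Reduced.differences216_of_analytic_two` with `θ_σ := 2K̄₀e^{−εR}`.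
[cite: Balaban1988RG2Cluster, (2.16) p.16, p.13] -/
theorem sub_ref_entry_le_torus (c : B13.Consts) (locp : p → UT Nf) (locn : n → UT Nf)
    (K : (TPt d N' → ℂ) → Matrix p n ℂ) {W : Type} {T : W → (TPt d N' → ℂ) → Matrix p n ℂ} {SX : Set W}
    {X : Finset (UT Nf)} {A : W → ℝ} {D : W → UT Nf → UT Nf → ℝ} {ρ ε R kap Kbar₀ : ℝ}
    (h : SigmaThroughWalks (toB6 (torusGeom Nf 0 0 0) 0 True) {σ : TPt d N' → ℂ | ∀ j, ‖σ j‖ ≤ Real.exp c.κ₁} 0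
      locp locn K T SX X A D ρ)
    (hε : 0 ≤ ε)
    (hsum : MajSumLe (g := toB6 (torusGeom Nf 0 0 0) 0 True)
      (fun ω a b => A ω * Real.exp (-((ρ - ε) * D ω a b))) (fun a b => Kbar₀ * Real.exp (-(kap * tdist1 Nf a b))))
    (hfar : ∀ i : p, ∀ z ∈ X, R ≤ tdist1 Nf (locp i) z) :
    ∀ σ : TPt d N' → ℂ, (∀ j, ‖σ j‖ ≤ Real.exp c.κ₁) →
      ∀ b j, ‖(K σ - K 0) b j‖ ≤ (2 * Kbar₀ * Real.exp (-(ε * R))) * Real.exp (-(kap * tdist1 Nf (locp b) (locn j))) := by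
  intro σ hσ b j
  have h₀ : (0 : TPt d N' → ℂ) ∈ {σ : TPt d N' → ℂ | ∀ j, ‖σ j‖ ≤ Real.exp c.κ₁} := fun _ => by
    rw [Pi.zero_apply, norm_zero]; exact (Real.exp_pos _).le
  have key : ‖(K σ - K 0) b j‖ ≤
      2 * (Kbar₀ * Real.exp (-(kap * tdist1 Nf (locp b) (locn j)))) * Real.exp (-(ε * R)) :=
    sub_ref_entry_le h h₀ (fun a b => tdist1_nonneg a b) hε hsum hfar hσ b j
  exact key.trans_eq (by ring)

end Torus

/-! ## §4. `Differences216` for one term with NO σ-part bound among the hypotheses -/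

section Capstone

variable {E : Type*} [NormedAddCommGroup E] [NormedSpace ℂ E]
variable {d N' : ℕ} {ν : ℕ} {Nf : Fin ν → ℕ} [∀ i, NeZero (Nf i)]
variable {Λ : Type} [Fintype Λ] [DecidableEq Λ] {C₀ : Type}

/-- **L16a FOR ONE TERM FROM THE WALK STRUCTURE + (T3b)** — `B13PrimitiveKernels216Reduced.differences216_of_analytic_two`
with its two (T3a) binders `hσΓ`, `hσE` DISCHARGED by `sub_ref_entry_le_torus`: for the joint families `G(σ,u)` (Γ-kernel),
`A(σ,u)` (precision) of a (2.14)-term with real reference values `G(0,0) = Γ₀`, `A(0,0)⁻¹ = C ≻ 0`, IF the σ-sections at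
the reference configuration `σ ↦ G(σ,0)`, `σ ↦ A(σ,0)` carry `SigmaThroughWalks` data over the site torus whose
reduced-rate majorant families are summable with bounds `K̄_Γe^{−κd₁}`, `K̄_Ee^{−κd₁}`, the σ-carrying walks passing
through a set `X` with `d₁(loc b, z) ≥ R_σ` for every row bond `b ∈ Λ` (print p. 13: `dist(X, Z₀) > ⅔M`), and (T3b) the
families are entrywise analytic in `u` on the `R`-ball with uniform torus-localised majorants `K_G`, `K_E`, `K_Cs`, THEN
at every configuration `‖u‖ ≤ α < R` (with `A(σ,u)` symmetric, `Re ≻ 0`) the section satisfies `Differences216` at any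
twice-dropped rate `0 ≤ κ″ < κ′ < κ` with `θ_Γ = 2K̄_Γe^{−εR_σ} + 2K_Gα/R`, `θ_E = 2K̄_Ee^{−εR_σ} + 2K_Eα/R` and the
derived `θ_C` — the printed `O(1)e^{−⅓δ₀M} + O(α₀ + α₁)` with BOTH parts now theorems about named structural
hypotheses (walk structure ∕ analyticity), no (2.16)-type bound assumed. [cite: Balaban1988RG2Cluster, (2.16) p.16, p.15, p.13, (1.11) p.5] -/
theorem differences216_of_walks_two (c : B13.Consts)
    (A2 : (TPt d N' → ℂ) → E → Matrix Λ Λ ℂ) (G2 : (TPt d N' → ℂ) → E → Matrix Λ (Λ ⊕ C₀) ℂ)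
    {Γ₀ : Matrix Λ (Λ ⊕ C₀) ℝ} {C : Matrix Λ Λ ℝ} (hC : C.PosDef) (locΛ : Λ → UT Nf) (locN : Λ ⊕ C₀ → UT Nf)
    {m : ℕ} (hfibΛ : ∀ x : UT Nf, (Finset.univ.filter fun i => locΛ i = x).card ≤ m)
    {R α kap kap' kap'' KG KCs KE : ℝ} (hR : 0 < R) (hαR : α < R) (hα : 0 ≤ α)
    (hkap'' : 0 ≤ kap'') (h1 : kap'' < kap') (h2 : kap' < kap)
    (hKG : 0 ≤ KG) (hKCs : 0 ≤ KCs) (hKE : 0 ≤ KE)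
    (hG0 : G2 0 0 = Γ₀.map (algebraMap ℝ ℂ)) (hC0 : (A2 0 0)⁻¹ = C.map (algebraMap ℝ ℂ))
    {u : E} (hu : ‖u‖ ≤ α)
    (hAs : ∀ σ : TPt d N' → ℂ, (∀ j, ‖σ j‖ ≤ Real.exp c.κ₁) → (A2 σ u).IsSymm)
    (hA : ∀ σ : TPt d N' → ℂ, (∀ j, ‖σ j‖ ≤ Real.exp c.κ₁) → ((A2 σ u).map Complex.re).PosDef)
    -- (T3a) REPLACED by the OBJECT-level walk structure of the σ-sections at the reference configuration
    {WΓ : Type} {TΓ : WΓ → (TPt d N' → ℂ) → Matrix Λ (Λ ⊕ C₀) ℂ} {SXΓ : Set WΓ} {AΓ : WΓ → ℝ}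
    {DΓ : WΓ → UT Nf → UT Nf → ℝ} {ρΓ : ℝ}
    {WE : Type} {TE : WE → (TPt d N' → ℂ) → Matrix Λ Λ ℂ} {SXE : Set WE} {AE : WE → ℝ}
    {DE : WE → UT Nf → UT Nf → ℝ} {ρE : ℝ}
    {X : Finset (UT Nf)} {ε Rσ KbarΓ KbarE : ℝ} (hε : 0 ≤ ε) (hKbarΓ : 0 ≤ KbarΓ) (hKbarE : 0 ≤ KbarE)
    (hwΓ : SigmaThroughWalks (toB6 (torusGeom Nf 0 0 0) 0 True) {σ : TPt d N' → ℂ | ∀ j, ‖σ j‖ ≤ Real.exp c.κ₁} 0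
      locΛ locN (fun σ => G2 σ 0) TΓ SXΓ X AΓ DΓ ρΓ)
    (hsumΓ : MajSumLe (g := toB6 (torusGeom Nf 0 0 0) 0 True)
      (fun ω a b => AΓ ω * Real.exp (-((ρΓ - ε) * DΓ ω a b))) (fun a b => KbarΓ * Real.exp (-(kap * tdist1 Nf a b))))
    (hwE : SigmaThroughWalks (toB6 (torusGeom Nf 0 0 0) 0 True) {σ : TPt d N' → ℂ | ∀ j, ‖σ j‖ ≤ Real.exp c.κ₁} 0
      locΛ locΛ (fun σ => A2 σ 0) TE SXE X AE DE ρE)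
    (hsumE : MajSumLe (g := toB6 (torusGeom Nf 0 0 0) 0 True)
      (fun ω a b => AE ω * Real.exp (-((ρE - ε) * DE ω a b))) (fun a b => KbarE * Real.exp (-(kap * tdist1 Nf a b))))
    (hfar : ∀ b : Λ, ∀ z ∈ X, Rσ ≤ tdist1 Nf (locΛ b) z)
    -- (T3b), reduced: analyticity of the Γ-kernel and of the PRECISION with uniform majorants; covariance majorant only
    (haΓ : ∀ σ : TPt d N' → ℂ, (∀ j, ‖σ j‖ ≤ Real.exp c.κ₁) →
      ∀ b j, DifferentiableOn ℂ (fun u => G2 σ u b j) (ball 0 R))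
    (hmΓ : ∀ σ : TPt d N' → ℂ, (∀ j, ‖σ j‖ ≤ Real.exp c.κ₁) → ∀ u ∈ ball (0 : E) R,
      ∀ b j, ‖G2 σ u b j‖ ≤ KG * Real.exp (-(kap * tdist1 Nf (locΛ b) (locN j))))
    (haE : ∀ σ : TPt d N' → ℂ, (∀ j, ‖σ j‖ ≤ Real.exp c.κ₁) →
      ∀ b b', DifferentiableOn ℂ (fun u => A2 σ u b b') (ball 0 R))
    (hmE : ∀ σ : TPt d N' → ℂ, (∀ j, ‖σ j‖ ≤ Real.exp c.κ₁) → ∀ u ∈ ball (0 : E) R,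
      ∀ b b', ‖A2 σ u b b'‖ ≤ KE * Real.exp (-(kap * tdist1 Nf (locΛ b) (locΛ b'))))
    (hmC : ∀ σ : TPt d N' → ℂ, (∀ j, ‖σ j‖ ≤ Real.exp c.κ₁) → ∀ u ∈ ball (0 : E) R,
      ∀ b b', ‖(A2 σ u)⁻¹ b b'‖ ≤ KCs * Real.exp (-(kap * tdist1 Nf (locΛ b) (locΛ b')))) :
    Differences216 c (fun σ => A2 σ u) (fun σ => G2 σ u) Γ₀ C locΛ locN kap''
      (2 * KbarΓ * Real.exp (-(ε * Rσ)) + 2 * KG * α / R)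
      (KCs * (2 * KbarE * Real.exp (-(ε * Rσ)) + 2 * KE * α / R) * (m * (1 + 2 / (kap - kap')) ^ ν) * KCs
        * (m * (1 + 2 / (kap' - kap'')) ^ ν))
      (2 * KbarE * Real.exp (-(ε * Rσ)) + 2 * KE * α / R) :=
  differences216_of_analytic_two c A2 G2 hC locΛ locN hfibΛ hR hαR hα hkap'' h1 h2 hKG hKCs hKE
    (by positivity) (by positivity) hG0 hC0 hu hAs hA
    (sub_ref_entry_le_torus c locΛ locN (fun σ => G2 σ 0) hwΓ hε hsumΓ hfar)
    (sub_ref_entry_le_torus c locΛ locΛ (fun σ => A2 σ 0) hwE hε hsumE hfar)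
    haΓ hmΓ haE hmE hmC

end Capstone

/-! ## §5. The same object gives the uniform localisation (L17a-type majorants): `‖K(s)(i,j)‖ ≤ K̄(loc i, loc j)` -/

section Localisation

variable {g : B6.Geometry}
variable {S : Type*} {P : Set S} {p n : Type} {locp : p → g.Site} {locn : n → g.Site}
variable {K : S → Matrix p n ℂ} {W : Type} {T : W → S → Matrix p n ℂ} {A : W → ℝ} {D : W → g.Site → g.Site → ℝ} {ρ : ℝ}

/-- **UNIFORM LOCALISATION FROM THE EXPANSION** (the entrywise form of [B9] p. 416 *"From (3.108) it follows that the
expansion (3.107) is convergent … This implies Theorem 3.3"*, cf. `B9SectDWalk.CvgTo.hasMaj_of_uniform`): an entrywise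
`HasSum` expansion with per-term bounds `A_ω e^{−ρD_ω(loc i, loc j)}` uniform on `P` and `MajSumLe` of that majorant family
with bound `K̄` gives `‖K(s)(i,j)‖ ≤ K̄(loc i, loc j)` on `P` — the shape of the L17a majorants (`Localisation17a.hG ∕ hCs`,
the binders `hmΓ hmE hmC` of `differences216_of_walks_two`), from the SAME object that carries (T3a).
[cite: Balaban1985BackgroundPropagators, (3.108) p.416; Balaban1988RG2Cluster, p.13, p.15] -/
theorem entry_le_of_hasSum_majorants
    (hK : ∀ s ∈ P, ∀ i j, HasSum (fun ω => T ω s i j) (K s i j)) (hA : ∀ ω, 0 ≤ A ω)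
    (hmaj : ∀ ω, ∀ s ∈ P, ∀ i j, ‖T ω s i j‖ ≤ A ω * Real.exp (-(ρ * D ω (locp i) (locn j))))
    {Kbar : g.Site → g.Site → ℝ} (hsum : MajSumLe (fun ω a b => A ω * Real.exp (-(ρ * D ω a b))) Kbar)
    {s : S} (hs : s ∈ P) (i : p) (j : n) : ‖K s i j‖ ≤ Kbar (locp i) (locn j) := by
  have hm0 : ∀ ω, 0 ≤ A ω * Real.exp (-(ρ * D ω (locp i) (locn j))) :=
    fun ω => mul_nonneg (hA ω) (Real.exp_pos _).le
  have hpart : ∀ Sf : Finset W, ∑ ω ∈ Sf, A ω * Real.exp (-(ρ * D ω (locp i) (locn j))) ≤ Kbar (locp i) (locn j) :=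
    fun Sf => hsum Sf (locp i) (locn j)
  have hmsum : Summable fun ω => A ω * Real.exp (-(ρ * D ω (locp i) (locn j))) :=
    summable_of_sum_le (fun ω => hm0 ω) hpart
  exact ((hK s hs i j).norm_le_of_bounded hmsum.hasSum fun ω => hmaj ω s hs i j).trans
    (hmsum.tsum_le_of_sum_le hpart)

/-- `SigmaThroughWalks` data carry the uniform localisation of the kernel at the FULL rate `ρ`: with `MajSumLe` of
`(A_ω e^{−ρD_ω})_ω` bounded by `K̄`, `‖K(s)(i,j)‖ ≤ K̄(loc i, loc j)` on `P`. [cite: Balaban1988RG2Cluster, p.13, p.15] -/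
theorem SigmaThroughWalks.entry_le {s₀ : S} {SX : Set W} {X : Finset g.Site}
    (h : SigmaThroughWalks g P s₀ locp locn K T SX X A D ρ) {Kbar : g.Site → g.Site → ℝ}
    (hsum : MajSumLe (fun ω a b => A ω * Real.exp (-(ρ * D ω a b))) Kbar) {s : S} (hs : s ∈ P) (i : p) (j : n) :
    ‖K s i j‖ ≤ Kbar (locp i) (locn j) :=
  entry_le_of_hasSum_majorants h.hasSum h.A_nonneg h.maj hsum hs i j

variable {d N' : ℕ} {ν : ℕ} {Nf : Fin ν → ℕ} [∀ i, NeZero (Nf i)]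
variable {E : Type*} [NormedAddCommGroup E]

/-- **The (T3b)-majorant binder shape from a JOINT expansion, on the site torus**: if for every σ of the polydisc and
every configuration `u` of the `R`-ball the joint kernel `K(σ,u)` is the entrywise `HasSum` of terms `T_ω(σ,u)` with
per-term bounds `A_ω e^{−ρD_ω(loc i, loc j)}` uniform on polydisc × ball, and the majorant family is `MajSumLe`-bounded by
`K̄₀e^{−κd₁}` (ℓ¹ torus distance), then `‖K(σ,u)(b,j)‖ ≤ K̄₀·e^{−κd₁(loc b, loc j)}` on polydisc × ball — literally the
binders `hmΓ` (columns `Λ ⊕ C₀`), `hmE`, `hmC` (columns `Λ`) of `differences216_of_walks_two` ∕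
`B13PrimitiveKernels216.localisation17a_of_majorants`, with `K_• := K̄₀`. [cite: Balaban1988RG2Cluster, p.15, p.13; Balaban1985BackgroundPropagators, (3.108) p.416] -/
theorem majorant_torus_of_hasSum (c : B13.Consts) (locp : p → UT Nf) (locn : n → UT Nf)
    (K2 : (TPt d N' → ℂ) → E → Matrix p n ℂ) {W : Type} {T2 : W → (TPt d N' → ℂ) → E → Matrix p n ℂ}
    {A : W → ℝ} {D : W → UT Nf → UT Nf → ℝ} {ρ R kap Kbar₀ : ℝ} (hA : ∀ ω, 0 ≤ A ω)
    (hK : ∀ σ : TPt d N' → ℂ, (∀ j, ‖σ j‖ ≤ Real.exp c.κ₁) → ∀ u ∈ ball (0 : E) R,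
      ∀ i j, HasSum (fun ω => T2 ω σ u i j) (K2 σ u i j))
    (hmaj : ∀ ω, ∀ σ : TPt d N' → ℂ, (∀ j, ‖σ j‖ ≤ Real.exp c.κ₁) → ∀ u ∈ ball (0 : E) R,
      ∀ i j, ‖T2 ω σ u i j‖ ≤ A ω * Real.exp (-(ρ * D ω (locp i) (locn j))))
    (hsum : MajSumLe (g := toB6 (torusGeom Nf 0 0 0) 0 True)
      (fun ω a b => A ω * Real.exp (-(ρ * D ω a b))) (fun a b => Kbar₀ * Real.exp (-(kap * tdist1 Nf a b)))) :
    ∀ σ : TPt d N' → ℂ, (∀ j, ‖σ j‖ ≤ Real.exp c.κ₁) → ∀ u ∈ ball (0 : E) R,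
      ∀ b j, ‖K2 σ u b j‖ ≤ Kbar₀ * Real.exp (-(kap * tdist1 Nf (locp b) (locn j))) := by
  intro σ hσ u hu b j
  exact entry_le_of_hasSum_majorants (g := toB6 (torusGeom Nf 0 0 0) 0 True) (P := ball (0 : E) R)
    (K := K2 σ) (T := fun ω u => T2 ω σ u) (locp := locp) (locn := locn)
    (fun u hu i j => hK σ hσ u hu i j) hA (fun ω u hu i j => hmaj ω σ hσ u hu i j) hsum hu b j

end Localisation

end

end Literature.MathematicalPhysics.QuantumFieldTheory.Balaban1983to89.B13SigmaThroughWalks
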